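import Summits.QuantumFields.YangMills.Theorems.BalabanLadderUVSeamRecCeilingsGuardedPeelingGlue
import Summits.QuantumFields.YangMills.Theorems.BalabanLadderUVSeamRecCeilingsGuardedPeelingOfUnguarded
import HarnessLib

/-!
# Crux `UVSeamRec` (stmt-QuantumFields-20043), lane B: the GUARDED one-box large-field input as NAMED PROPOSITIONS — `GuardedConditionalRaritySU2`
# and the v8d «background field» package `BackgroundFieldGUCRSU2` — with the one-line glue to `ResponseMomentsOdd6SU2`

Definition file (`--kind definition --supports stmt-QuantumFields-20043`) of the width-lever seat `ym-20043-ceilings-p2` (lane B, gen 9), in the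
style of the LEAD's `…ClassicalResponseGlue` (named Props `SplitCl`, `EMI`, `BackgroundFieldSU2`, `GaussianDominationSU2` of the v6(β-cl) glue,
p548409).  It names the large-field half of lane B's gen 9 currency so that a v8d skeleton of `stub_responseMomentsOdd6` can register ONE-NAME stubs
(`UV → BackgroundFieldGUCRSU2`, `UV → GaussianDominationSU2`) and close the registered (RM) stub by `exact` one theorem:
* `GuardedConditionalRaritySU2 𝔟 ε β₁ m s ρ w` — (GUCR): for `β ≥ β₁`, every level `k ≥ 1`, every threshold `e ≥ ε β k`, block index `z`, orientation
  `μ<ν` and EVERY exterior `η`, the Wilson kernel (`SU(2)`, fundamental) of the collar cube (collar `m`) of the b-adic `s`-PARENT block, corner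
  `b^{k+s}(z/b^s − m)`, side `(2m+1)b^{k+s}`, gives the GUARDED event «`blockField_k(z) ≥ e` and NOT `blockField_{k+s}(z/b^s) ≥ ρe`» mean `≤ w β k`.
* `BackgroundFieldGUCRSU2` — (BF-GUCR): tempering data and constants with (split-cl) `SplitCl`, a UNIFORM threshold floor `0 < ε₀ ≤ ε β k`, guard data
  `1 ≤ J`, `0 ≤ ρ`, `2 < ρ^J ε₀`, schedule `ε β (k+s) ≤ ρ ε β k`, collar `3 ≤ m`, weights `w ≥ 0` with (GUCR), and the plain budget `Σ_{1≤k≤kmax β R} w β k ≤ D`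
  (= the body of the v8d candidate's `stub_backgroundFieldGUCR`, evidence #59 on the item).
* `responseMomentsOdd6SU2_of_backgroundFieldGUCR_and_gaussianDomination : BackgroundFieldGUCRSU2 → GaussianDominationSU2 → ResponseMomentsOdd6SU2`
  (= `DLRPeeling.responseMomentsOdd6SU2_of_splitCl_gaussianDomination_guardedConditionalRarity`, p593010).
* `guardedConditionalRaritySU2_of_uniformConditionalRarity` — the UNGUARDED (UCR) of v8/v8b/v8c (collar `m ≥ 1`, threshold `ε β k`, child's collar cube)
  implies (GUCR) with the same weights for every guard depth `s ≥ 1` and ratio `ρ` (p593346) — v8d's large-field clause is the WEAKER ask.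
HONEST FRAMING: names and composition only; (GUCR) is an OPEN renormalisation-group input of Bałaban's kind (R-operation currency with Dirichlet data,
guarded by the next coarser scale; its freedom from the flat-penetration floor of (UCR) is a heuristic); nothing of E0′; not a gap, not Clay.
References: folklore; T. Bałaban, Commun. Math. Phys. 122 (1989) 175–202, 355–392.
-/

set_option autoImplicit false

noncomputable section

open MeasureTheory Filter Topology Finset
open Literature.MathematicalPhysics.QuantumFieldTheory (LatticeRep)
open Literature.MathematicalPhysics.QuantumLattice
open Summit.QuantumFields.YangMills.Cruxes.OSLegsFromFemtoAndGap.DlrCollarTransfer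
open Summit.QuantumFields.YangMills.Cruxes.UVSeamRec.ClassicalResponse
open Summit.QuantumFields.YangMills.Cruxes.UVSeamRec.PolymerData

namespace Summit.QuantumFields.YangMills.Cruxes.UVSeamRec.DLRPeeling

/-- **(GUCR) «GUARDED UNIFORM CONDITIONAL RARITY»** at `SU(2)`, fundamental representation: block size `𝔟`, thresholds `ε β k`, onset `β₁`, collar
`m`, guard depth `s`, ratio `ρ`, weights `w β k`.  For `β ≥ β₁`, every level `k ≥ 1`, every threshold `e ≥ ε β k`, every block index `z`, orientation
`μ < ν` and EVERY exterior `η`: the Wilson kernel of the collar cube of the b-adic `s`-parent block (corner `b^{k+s}(z/b^s − m)`, side `(2m+1)b^{k+s}`)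
gives the guarded event «level-`k` block plaquette `(k, z, μν)` is `e`-large and its parent `(k+s, z/b^s, μν)` is NOT `ρe`-large» probability
`≤ w β k`.  (Bałaban's large-field rarity in ONE box with Dirichlet data, guarded by the next coarser scale; OPEN.) -/
def GuardedConditionalRaritySU2 (𝔟 : BlockSize) (ε : ℝ → ℕ → ℝ) (β₁ : ℝ) (m s : ℕ) (ρ : ℝ) (w : ℝ → ℕ → ℝ) : Prop :=
  ∀ β : ℝ, β₁ ≤ β → ∀ k : ℕ, 1 ≤ k → ∀ e : ℝ, ε β k ≤ e → ∀ (z : Fin 4 → ℤ) (μ ν : Fin 4) (h : μ < ν)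
    (η : LGConfig 4 (Matrix.specialUnitaryGroup (Fin 2) ℂ)),
    kerE (Matrix.specialUnitaryGroup (Fin 2) ℂ) (fundamentalLatticeRep 2) β
      (fun c => (𝔟.b : ℤ) ^ (k + s) * (z c / (𝔟.b : ℤ) ^ s - m)) ((2 * m + 1) * 𝔟.b ^ (k + s)) η
      ((largeFieldEvent (N := 2) 𝔟 e ⟨k, z, μ, ν, h⟩ \
        largeFieldEvent (N := 2) 𝔟 (ρ * e) ⟨k + s, fun c => z c / (𝔟.b : ℤ) ^ s, μ, ν, h⟩).indicator fun _ => (1 : ℝ)) ≤ w β k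

/-- **(BF-GUCR) «BACKGROUND FIELD with GUARDED UNIFORM CONDITIONAL RARITY»** — the would-be first stub of v8d(β-cl-GUCR): tempering data `𝔟 ε kmax`,
constants `C_s C₁ A₀ P₀ β₁ ℓ₁ D ε₀`, reference values `p`, collar `m`, guard data `s J ρ`, weights `w`, with (split-cl) `SplitCl 𝔟 ε kmax C_s C₁ A₀ β₁ ℓ₁ p`,
a UNIFORM threshold floor `0 < ε₀ ≤ ε β k`, `1 ≤ J`, `0 ≤ ρ`, termination `2 < ρ^J ε₀`, schedule `ε β (k+s) ≤ ρ·ε β k`, `3 ≤ m`, `w ≥ 0`, (GUCR), and the PLAIN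
budget `Σ_{1≤k≤kmax β R} w β k ≤ D`.  ONE package because (split-cl) and (GUCR) share the tempering data.  OPEN (E0′-K with background + Bałaban's
R-operation currency). -/
def BackgroundFieldGUCRSU2 : Prop :=
  ∃ (𝔟 : BlockSize) (ε : ℝ → ℕ → ℝ) (kmax : ℝ → ℕ → ℕ) (C_s C₁ A₀ P₀ β₁ ℓ₁ D ε₀ : ℝ) (p : Fin 4 × Fin 4 → ℝ → ℝ)
    (m s J : ℕ) (ρ : ℝ) (w : ℝ → ℕ → ℝ),
    0 < C_s ∧ 0 < C₁ ∧ 0 ≤ A₀ ∧ 0 < ℓ₁ ∧ (∀ q β, |p q β| ≤ P₀) ∧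
    SplitCl 𝔟 ε kmax C_s C₁ A₀ β₁ ℓ₁ p ∧ 0 < ε₀ ∧ (∀ β k, ε₀ ≤ ε β k) ∧
    1 ≤ J ∧ 0 ≤ ρ ∧ 2 < ρ ^ J * ε₀ ∧ (∀ β k, ε β (k + s) ≤ ρ * ε β k) ∧
    3 ≤ m ∧ (∀ β k, 0 ≤ w β k) ∧ GuardedConditionalRaritySU2 𝔟 ε β₁ m s ρ w ∧
    (∀ β : ℝ, β₁ ≤ β → ∀ R : ℕ, ∑ k ∈ (Finset.range (kmax β R + 1)).filter (fun k => 1 ≤ k), w β k ≤ D)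

/-- **THE v8d GLUE BY NAME: (BF-GUCR) → (GD) → `ResponseMomentsOdd6SU2`** (= `responseMomentsOdd6SU2_of_splitCl_gaussianDomination_guardedConditionalRarity`,
p593010).  HONEST FRAMING: composition of OPEN inputs; nothing of E0′. [folklore] -/
theorem responseMomentsOdd6SU2_of_backgroundFieldGUCR_and_gaussianDomination
    (hBF : BackgroundFieldGUCRSU2) (hGD : GaussianDominationSU2) : ResponseMomentsDefs.ResponseMomentsOdd6SU2 := by
  obtain ⟨𝔟, ε, kmax, C_s, C₁, A₀, P₀, β₁, ℓ₁, D, ε₀, p, m, s, J, ρ, w, hCs, hC₁, hA₀, hℓ₁, hp, hsplit, hε₀, hε, hJ, hρ, hρJ,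
    hsched, hm, hw0, hGUCR, hD⟩ := hBF
  exact responseMomentsOdd6SU2_of_splitCl_gaussianDomination_guardedConditionalRarity 𝔟 ε kmax hCs hC₁ hA₀ hℓ₁ hp hsplit hGD hε₀ hε
    s J hJ ρ hρ hρJ hsched m hm w hw0 hGUCR hD

/-- **(UCR) ⇒ (GUCR) by name**: the unguarded one-box bound of v8/v8b/v8c — for `β ≥ β₁`, `k ≥ 1`, every `z μ<ν` and EVERY exterior `ζ`,
`kerE^ζ_{(b^k(z−m),(2m+1)b^k)}(1_{largeFieldEvent (ε β k) (k,z,μν)}) ≤ w β k`, collar `m ≥ 1` — gives `GuardedConditionalRaritySU2 𝔟 ε β₁ m s ρ w` for every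
guard depth `s ≥ 1` and every ratio `ρ` (p593346: the child's collar cube sits in the parent's; DLR consistency; monotonicity).  So the v8d ask is the
weaker one. [folklore] -/
theorem guardedConditionalRaritySU2_of_uniformConditionalRarity (𝔟 : BlockSize) (ε : ℝ → ℕ → ℝ) (β₁ : ℝ) {m s : ℕ} (hm : 1 ≤ m)
    (hs : 1 ≤ s) (ρ : ℝ) (w : ℝ → ℕ → ℝ)
    (hUCR : ∀ β : ℝ, β₁ ≤ β → ∀ k : ℕ, 1 ≤ k → ∀ (z : Fin 4 → ℤ) (μ ν : Fin 4) (h : μ < ν)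
      (ζ : LGConfig 4 (Matrix.specialUnitaryGroup (Fin 2) ℂ)),
      kerE (Matrix.specialUnitaryGroup (Fin 2) ℂ) (fundamentalLatticeRep 2) β (fun i => (𝔟.b : ℤ) ^ k * (z i - m)) ((2 * m + 1) * 𝔟.b ^ k) ζ
        ((largeFieldEvent (N := 2) 𝔟 (ε β k) ⟨k, z, μ, ν, h⟩).indicator fun _ => (1 : ℝ)) ≤ w β k) :
    GuardedConditionalRaritySU2 𝔟 ε β₁ m s ρ w :=
  fun β hβ k hk _ he z μ ν h η =>
    guardedConditionalRarity_of_uniformConditionalRarity (fundamentalLatticeRep 2) β 𝔟 k z μ ν h hm hs ρ he (hUCR β hβ k hk z μ ν h) η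

end Summit.QuantumFields.YangMills.Cruxes.UVSeamRec.DLRPeeling

end
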